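import Summits.AtomisticToContinuum.Crystallization.Theses.SymmetryRankLadder

/-!
# Birth skeleton — crux `SymmetryRankLadder.MonolayerStackOptimality`

Item `stmt-AtomisticToContinuum-5833` (crux, rank 4, route `SymmetryRankLadder`, sub-problem
`Crystallization`; piece X₃ of the BC2-redirect decomposition of the deciding crux
`HcpPeriodicMinimiser`, stmt-AtomisticToContinuum-3061, assembly
`Cruxes/HcpPeriodicMinimiser/SplitAssembly.lean`).

The crux (S2′): every periodic MONOLAYER TRIANGULAR STACK — `A₂(a)`-layers, `a ∈ [47/50, 1]`,
arbitrary lateral offsets ("continuous letters"), consecutive spacings free in `[7/10, 1]` — has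
Lennard-Jones energy per particle `≥` that of some relaxed hcp `hcpPeriodicConfiguration a' h` with
`(a', h)` in the box `B = [47/50, 1] × [39a'/50, 17a'/20]`.

First cut — CONTINUOUS → DISCRETE → UNIFORM (three named stubs), along the two seams the sibling
programme has already certified. Intermediate class: HOLE-REGISTERED STACKS at in-plane constant `a` —
monolayer triangular stacks in which any two points differ laterally by a vector of
`ℤu_a + ℤv_a + ℤw_a` (`w_a = barlowOffset a`, the deep-hole offset; every layer carries a letter
A/B/C relative to a common origin) and layers at vertical distance `≤ 1` (adjacent ones) carry
DIFFERENT letters (lateral difference `∉ ℤu_a + ℤv_a`): Barlow-type stackings with a free Hägg word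
and FREE spacings.

* `stub_offsetHoleLocking` — every monolayer triangular stack at constant `a` is matched, at no higher
  energy per particle, by a hole-registered stack at the same `a` (offsets lock into deep holes; the
  spacings may be kept). The continuous-letter content of the crux: adjacent-layer registry potential
  `Φ_t(u) = Σ_(λ ∈ Λ_a) V(√(|λ+u|² + t²))` minimised at the holes for `t ∈ [7/10, 1]`
  (`PoissonBesselStacking.AdjacentLayerHoleLocking`, item 3064, states it on `t ∈ [39a/50, 17a/20]`;
  first dual shell `φ̂_t(ξ₁) > 0` while `t/a < 1.10`, here `t/a ≤ 1/0.94 = 1.064`) plus the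
  second-neighbour layers (`|Δz| ≥ 7/5`, corrections `≤ 1e−4`, Bessel-signed:
  `RegistryCouplingBesselTail` 3068) — a layer-by-layer relaxation to holes that never raises the
  energy. Size M–L; open (3064 is open); strictly weaker than the crux in form (no hcp, no box).
* `stub_spacingBoxing` — every hole-registered stack (`a ∈ [47/50,1]`, spacings in `[7/10, 1]`) is
  matched, at no higher energy per particle, by a hole-registered stack at some `a' ∈ [47/50, 1]`
  whose consecutive spacings lie in the box window `[39a'/50, 17a'/20]`. Certified 1-D numerics: at
  hole registry the adjacent-layer interaction `t ↦ layerInteraction lennardJones a t 1 1` is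
  decreasing-then-increasing with minimiser `≈ 0.8165 a` well inside the window and the non-adjacent
  layers contribute `O(1e−3)`; spacings outside the window are moved to its boundary one gap at a
  time (with the in-plane re-relaxation `a ↦ a'` absorbing the coupled first-order change). Size M;
  new certified interval work, no new idea. Not the crux (both classes are hole-registered).
* `stub_boxedHoleStackBelowHcp` — every hole-registered stack with `a ∈ [47/50, 1]` and spacings in
  `[39a/50, 17a/20]` has energy per particle `≥ e(hcp a' h)` for some `(a', h) ∈ B`. PROVABLE NOW
  from landed/certified pieces (size M, bookkeeping + two proved seams): identify the point-set class
  with the layer-cake energy `Σ_m (Φ₀(a) + Σ_(m' ≠ m) layerInteraction lennardJones a (z_m' − z_m)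
  (label difference) 1)` (as `LayeredHull.stub_layerCake` does for the hull class of 11779); the WORD
  side — restacking any Hägg word to the alternating one at fixed spacings does not raise the energy —
  is `LayeredSeam.restackAlternating` (proved, `Cruxes/PeriodicReductionToBarlow/layered_seam.lean`,
  from the landed certified `LayeredHull.stub_registry`), and the SPACING side — uniformising the
  spacings of an alternating stack to their mean `h̄ ∈ [39a/50, 17a/20]` does not raise the energy —
  is `LayeredSeam.uniformBarlowFloor` (proved, `LayeredSeamReduction.lean`, Jensen on the certified
  midpoint convexity `LayeredHull.stub_convexity`); `barlowPeriodicConfiguration alternatingHagg a h̄`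
  IS `hcpPeriodicConfiguration` (rfl). Equivalently: `PricedHcpWindowsLjRegistry.stub_ljRegistryDomination`
  (3063, landed) + `PricedHcpWindowsHaggDomination.stub_haggDominationAllRanges` (0737, landed) +
  `PricedHcpWindowsBarlowEnergy.stub_barlowEnergyIdentification` (3065, landed) for the uniform case.

Assembly `MonolayerStackOptimality_of` (real proof, no `sorry`): lock the offsets (stub 1), box the
spacings (stub 2), compare with hcp (stub 3), chain `e(hcp a' h) ≤ e(Q₂) ≤ e(Q₁) ≤ e(Q)`; concludes
`SymmetryRankLadder.MonolayerStackOptimality` BY NAME. `MonolayerStackOptimality_proof` instantiates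
it (sorries: exactly the three stubs). BC3 probes: `Cruxes/HcpPeriodicMinimiser/BC2-REDIRECT.md`.
Disproof used: none on file for 5833/3061; the sibling's `PeriodicGivenLayered/Disproof.lean` lesson
(free spacings and free words are each fatal WITHOUT energetics) is honoured: stub 3 keeps both
energetic seams, stubs 1–2 are energy comparisons, nothing is asserted about minimisers' structure.
Negatives index: no refuted statement of the summit is an instance of a stub.
-/

namespace Summit.AtomisticToContinuum.Crystallization.Cruxes.MonolayerStackOptimality.Birth

/-- **Stub 1 — offset hole locking (continuous → discrete letters).** Every periodic monolayer
triangular stack (`A₂(a)`-layers, `a ∈ [47/50, 1]`, arbitrary lateral offsets, spacings in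
`[7/10, 1]`) is matched, at no higher Lennard-Jones energy per particle, by a HOLE-REGISTERED stack
at the same `a`: any two points differ laterally by a vector of `ℤu_a + ℤv_a + ℤw_a` and layers at
vertical distance `≤ 1` carry different letters. Open (M–L; contains the global form of
`AdjacentLayerHoleLocking` 3064 on spacings `[7/10, 1]`); weaker than the crux in form. -/
theorem stub_offsetHoleLocking : ∀ Q : Literature.MathematicalPhysics.StatisticalMechanics.PeriodicConfiguration 3, ∀ a : ℝ, 47 / 50 ≤ a → a ≤ 1 → Literature.MathematicalPhysics.StatisticalMechanics.triangularVec₁ a ∈ Q.lattice ∧ Literature.MathematicalPhysics.StatisticalMechanics.triangularVec₂ a ∈ Q.lattice ∧ (∀ x ∈ Q.points, ∀ y ∈ Q.points, x 2 = y 2 → x - y ∈ Submodule.span ℤ ({Literature.MathematicalPhysics.StatisticalMechanics.triangularVec₁ a, Literature.MathematicalPhysics.StatisticalMechanics.triangularVec₂ a} : Set (EuclideanSpace ℝ (Fin 3)))) ∧ (∀ x ∈ Q.points, ∀ y ∈ Q.points, x 2 ≠ y 2 → (7 / 10 : ℝ) ≤ |x 2 - y 2|) ∧ (∀ x ∈ Q.points,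 ∃ y ∈ Q.points, (7 / 10 : ℝ) ≤ y 2 - x 2 ∧ y 2 - x 2 ≤ 1) → ∃ Q' : Literature.MathematicalPhysics.StatisticalMechanics.PeriodicConfiguration 3, Q'.energyPerParticle Literature.MathematicalPhysics.StatisticalMechanics.lennardJones ≤ Q.energyPerParticle Literature.MathematicalPhysics.StatisticalMechanics.lennardJones ∧ Literature.MathematicalPhysics.StatisticalMechanics.triangularVec₁ a ∈ Q'.lattice ∧ Literature.MathematicalPhysics.StatisticalMechanics.triangularVec₂ a ∈ Q'.lattice ∧ (∀ x ∈ Q'.points, ∀ y ∈ Q'.points, x 2 = y 2 → x - y ∈ Submodule.span ℤ ({Literature.MathematicalPhysics.StatisticalMechanics.triangularVec₁ a, Literature.MathematicalPhysics.StatisticalMechanics.triangularVec₂ a} : Set (EuclideanSpace ℝ (Fin 3)))) ∧ (∀ x ∈ Q'.points, ∀ y ∈ Q'.points, x 2 ≠ y 2 → (7 / 10 : ℝ) ≤ |x 2 - y 2|) ∧ (∀ x ∈ Q'.points, ∃ y ∈ Q'.points, (7 / 10 : ℝ) ≤ y 2 - x 2 ∧ y 2 - x 2 ≤ 1) ∧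 (∀ x ∈ Q'.points, ∀ y ∈ Q'.points, ∃ k : ℤ, x - y - Literature.MathematicalPhysics.StatisticalMechanics.layerNormal (x 2 - y 2) - (k : ℝ) • Literature.MathematicalPhysics.StatisticalMechanics.barlowOffset a ∈ Submodule.span ℤ ({Literature.MathematicalPhysics.StatisticalMechanics.triangularVec₁ a, Literature.MathematicalPhysics.StatisticalMechanics.triangularVec₂ a} : Set (EuclideanSpace ℝ (Fin 3)))) ∧ (∀ x ∈ Q'.points, ∀ y ∈ Q'.points, x 2 ≠ y 2 → |x 2 - y 2| ≤ 1 → x - y - Literature.MathematicalPhysics.StatisticalMechanics.layerNormal (x 2 - y 2) ∉ Submodule.span ℤ ({Literature.MathematicalPhysics.StatisticalMechanics.triangularVec₁ a, Literature.MathematicalPhysics.StatisticalMechanics.triangularVec₂ a} : Set (EuclideanSpace ℝ (Fin 3)))) := by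
  sorry

/-- **Stub 2 — spacing boxing.** Every hole-registered stack (`a ∈ [47/50, 1]`, spacings in
`[7/10, 1]`) is matched, at no higher energy per particle, by a hole-registered stack at some
`a' ∈ [47/50, 1]` all of whose consecutive spacings lie in `[39a'/50, 17a'/20]`. Certified 1-D
numerics (M): the hole-registry adjacent-layer interaction is minimised near `0.8165 a`, inside the
window, and dominates the non-adjacent layers. -/
theorem stub_spacingBoxing : ∀ Q : Literature.MathematicalPhysics.StatisticalMechanics.PeriodicConfiguration 3, ∀ a : ℝ, 47 / 50 ≤ a → a ≤ 1 → Literature.MathematicalPhysics.StatisticalMechanics.triangularVec₁ a ∈ Q.lattice ∧ Literature.MathematicalPhysics.StatisticalMechanics.triangularVec₂ a ∈ Q.lattice ∧ (∀ x ∈ Q.points, ∀ y ∈ Q.points, x 2 = y 2 → x - y ∈ Submodule.span ℤ ({Literature.MathematicalPhysics.StatisticalMechanics.triangularVec₁ a, Literature.MathematicalPhysics.StatisticalMechanics.triangularVec₂ a} : Set (EuclideanSpace ℝ (Fin 3)))) ∧ (∀ x ∈ Q.points, ∀ y ∈ Q.points, x 2 ≠ y 2 → (7 / 10 : ℝ)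 ≤ |x 2 - y 2|) ∧ (∀ x ∈ Q.points, ∃ y ∈ Q.points, (7 / 10 : ℝ) ≤ y 2 - x 2 ∧ y 2 - x 2 ≤ 1) ∧ (∀ x ∈ Q.points, ∀ y ∈ Q.points, ∃ k : ℤ, x - y - Literature.MathematicalPhysics.StatisticalMechanics.layerNormal (x 2 - y 2) - (k : ℝ) • Literature.MathematicalPhysics.StatisticalMechanics.barlowOffset a ∈ Submodule.span ℤ ({Literature.MathematicalPhysics.StatisticalMechanics.triangularVec₁ a, Literature.MathematicalPhysics.StatisticalMechanics.triangularVec₂ a} : Set (EuclideanSpace ℝ (Fin 3)))) ∧ (∀ x ∈ Q.points, ∀ y ∈ Q.points, x 2 ≠ y 2 → |x 2 - y 2| ≤ 1 → x - y - Literature.MathematicalPhysics.StatisticalMechanics.layerNormal (x 2 - y 2) ∉ Submodule.span ℤ ({Literature.MathematicalPhysics.StatisticalMechanics.triangularVec₁ a, Literature.MathematicalPhysics.StatisticalMechanics.triangularVec₂ a} : Set (EuclideanSpace ℝ (Fin 3)))) → ∃ Q' : Literature.MathematicalPhysics.StatisticalMechanics.PeriodicConfiguration 3, ∃ a' : ℝ,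 47 / 50 ≤ a' ∧ a' ≤ 1 ∧ Q'.energyPerParticle Literature.MathematicalPhysics.StatisticalMechanics.lennardJones ≤ Q.energyPerParticle Literature.MathematicalPhysics.StatisticalMechanics.lennardJones ∧ (Literature.MathematicalPhysics.StatisticalMechanics.triangularVec₁ a' ∈ Q'.lattice ∧ Literature.MathematicalPhysics.StatisticalMechanics.triangularVec₂ a' ∈ Q'.lattice ∧ (∀ x ∈ Q'.points, ∀ y ∈ Q'.points, x 2 = y 2 → x - y ∈ Submodule.span ℤ ({Literature.MathematicalPhysics.StatisticalMechanics.triangularVec₁ a', Literature.MathematicalPhysics.StatisticalMechanics.triangularVec₂ a'} : Set (EuclideanSpace ℝ (Fin 3)))) ∧ (∀ x ∈ Q'.points, ∀ y ∈ Q'.points, x 2 ≠ y 2 → (7 / 10 : ℝ) ≤ |x 2 - y 2|) ∧ (∀ x ∈ Q'.points, ∃ y ∈ Q'.points, (7 / 10 : ℝ) ≤ y 2 - x 2 ∧ y 2 - x 2 ≤ 1) ∧ (∀ x ∈ Q'.points, ∀ y ∈ Q'.points, ∃ k : ℤ, x - y - Literature.MathematicalPhysics.StatisticalMechanics.layerNormal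 (x 2 - y 2) - (k : ℝ) • Literature.MathematicalPhysics.StatisticalMechanics.barlowOffset a' ∈ Submodule.span ℤ ({Literature.MathematicalPhysics.StatisticalMechanics.triangularVec₁ a', Literature.MathematicalPhysics.StatisticalMechanics.triangularVec₂ a'} : Set (EuclideanSpace ℝ (Fin 3)))) ∧ (∀ x ∈ Q'.points, ∀ y ∈ Q'.points, x 2 ≠ y 2 → |x 2 - y 2| ≤ 1 → x - y - Literature.MathematicalPhysics.StatisticalMechanics.layerNormal (x 2 - y 2) ∉ Submodule.span ℤ ({Literature.MathematicalPhysics.StatisticalMechanics.triangularVec₁ a', Literature.MathematicalPhysics.StatisticalMechanics.triangularVec₂ a'} : Set (EuclideanSpace ℝ (Fin 3))))) ∧ (∀ x ∈ Q'.points, ∀ y ∈ Q'.points, x 2 ≠ y 2 → 39 / 50 * a' ≤ |x 2 - y 2|) ∧ (∀ x ∈ Q'.points, ∃ y ∈ Q'.points, 39 / 50 * a' ≤ y 2 - x 2 ∧ y 2 - x 2 ≤ 17 / 20 * a') := by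
  sorry

/-- **Stub 3 — boxed hole-registered stacks lie above relaxed hcp.** Every hole-registered stack
with `a ∈ [47/50, 1]` and spacings in `[39a/50, 17a/20]` has energy per particle `≥ e(hcp a' h)` for
some `(a', h) ∈ B`. Provable now (M): layer-cake identification + the two PROVED seams of the sibling
crux `PeriodicReductionToBarlow` (word side `LayeredSeam.restackAlternating` from the landed certified
registry sign; spacing side `LayeredSeam.uniformBarlowFloor`, Jensen on the landed certified midpoint
convexity), `barlowPeriodicConfiguration alternatingHagg a h̄ = hcpPeriodicConfiguration` by `rfl`. -/
theorem stub_boxedHoleStackBelowHcp : ∀ Q : Literature.MathematicalPhysics.StatisticalMechanics.PeriodicConfiguration 3, ∀ a : ℝ, 47 / 50 ≤ a → a ≤ 1 → Literature.MathematicalPhysics.StatisticalMechanics.triangularVec₁ a ∈ Q.lattice ∧ Literature.MathematicalPhysics.StatisticalMechanics.triangularVec₂ a ∈ Q.lattice ∧ (∀ x ∈ Q.points, ∀ y ∈ Q.points, x 2 = y 2 → x - y ∈ Submodule.span ℤ ({Literature.MathematicalPhysics.StatisticalMechanics.triangularVec₁ a, Literature.MathematicalPhysics.StatisticalMechanics.triangularVec₂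 a} : Set (EuclideanSpace ℝ (Fin 3)))) ∧ (∀ x ∈ Q.points, ∀ y ∈ Q.points, x 2 ≠ y 2 → (7 / 10 : ℝ) ≤ |x 2 - y 2|) ∧ (∀ x ∈ Q.points, ∃ y ∈ Q.points, (7 / 10 : ℝ) ≤ y 2 - x 2 ∧ y 2 - x 2 ≤ 1) ∧ (∀ x ∈ Q.points, ∀ y ∈ Q.points, ∃ k : ℤ, x - y - Literature.MathematicalPhysics.StatisticalMechanics.layerNormal (x 2 - y 2) - (k : ℝ) • Literature.MathematicalPhysics.StatisticalMechanics.barlowOffset a ∈ Submodule.span ℤ ({Literature.MathematicalPhysics.StatisticalMechanics.triangularVec₁ a, Literature.MathematicalPhysics.StatisticalMechanics.triangularVec₂ a} : Set (EuclideanSpace ℝ (Fin 3)))) ∧ (∀ x ∈ Q.points, ∀ y ∈ Q.points, x 2 ≠ y 2 → |x 2 - y 2| ≤ 1 → x - y - Literature.MathematicalPhysics.StatisticalMechanics.layerNormal (x 2 - y 2) ∉ Submodule.span ℤ ({Literature.MathematicalPhysics.StatisticalMechanics.triangularVec₁ a, Literature.MathematicalPhysics.StatisticalMechanics.triangularVec₂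 a} : Set (EuclideanSpace ℝ (Fin 3)))) → (∀ x ∈ Q.points, ∀ y ∈ Q.points, x 2 ≠ y 2 → 39 / 50 * a ≤ |x 2 - y 2|) ∧ (∀ x ∈ Q.points, ∃ y ∈ Q.points, 39 / 50 * a ≤ y 2 - x 2 ∧ y 2 - x 2 ≤ 17 / 20 * a) → ∃ a' h : ℝ, ∃ (ha : a' ≠ 0) (hh : h ≠ 0), 47 / 50 ≤ a' ∧ a' ≤ 1 ∧ 39 / 50 * a' ≤ h ∧ h ≤ 17 / 20 * a' ∧ (Literature.MathematicalPhysics.StatisticalMechanics.hcpPeriodicConfiguration ha hh).energyPerParticle Literature.MathematicalPhysics.StatisticalMechanics.lennardJones ≤ Q.energyPerParticle Literature.MathematicalPhysics.StatisticalMechanics.lennardJones := by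
  sorry

/-- **Assembly**: stub 1 → stub 2 → stub 3 → the crux (lock, box, compare, chain). Concludes
`SymmetryRankLadder.MonolayerStackOptimality` by name; no `sorry`. -/
theorem MonolayerStackOptimality_of : (∀ Q : Literature.MathematicalPhysics.StatisticalMechanics.PeriodicConfiguration 3, ∀ a : ℝ, 47 / 50 ≤ a → a ≤ 1 → Literature.MathematicalPhysics.StatisticalMechanics.triangularVec₁ a ∈ Q.lattice ∧ Literature.MathematicalPhysics.StatisticalMechanics.triangularVec₂ a ∈ Q.lattice ∧ (∀ x ∈ Q.points, ∀ y ∈ Q.points, x 2 = y 2 → x - y ∈ Submodule.span ℤ ({Literature.MathematicalPhysics.StatisticalMechanics.triangularVec₁ a, Literature.MathematicalPhysics.StatisticalMechanics.triangularVec₂ a} : Set (EuclideanSpace ℝ (Fin 3)))) ∧ (∀ x ∈ Q.points, ∀ y ∈ Q.points, x 2 ≠ y 2 → (7 / 10 : ℝ) ≤ |x 2 - y 2|) ∧ (∀ x ∈ Q.points, ∃ y ∈ Q.points, (7 / 10 : ℝ) ≤ y 2 - x 2 ∧ y 2 - x 2 ≤ 1) → ∃ Q' : Literature.MathematicalPhysics.StatisticalMechanics.PeriodicConfiguration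 3, Q'.energyPerParticle Literature.MathematicalPhysics.StatisticalMechanics.lennardJones ≤ Q.energyPerParticle Literature.MathematicalPhysics.StatisticalMechanics.lennardJones ∧ Literature.MathematicalPhysics.StatisticalMechanics.triangularVec₁ a ∈ Q'.lattice ∧ Literature.MathematicalPhysics.StatisticalMechanics.triangularVec₂ a ∈ Q'.lattice ∧ (∀ x ∈ Q'.points, ∀ y ∈ Q'.points, x 2 = y 2 → x - y ∈ Submodule.span ℤ ({Literature.MathematicalPhysics.StatisticalMechanics.triangularVec₁ a, Literature.MathematicalPhysics.StatisticalMechanics.triangularVec₂ a} : Set (EuclideanSpace ℝ (Fin 3)))) ∧ (∀ x ∈ Q'.points, ∀ y ∈ Q'.points, x 2 ≠ y 2 → (7 / 10 : ℝ) ≤ |x 2 - y 2|) ∧ (∀ x ∈ Q'.points, ∃ y ∈ Q'.points, (7 / 10 : ℝ) ≤ y 2 - x 2 ∧ y 2 - x 2 ≤ 1) ∧ (∀ x ∈ Q'.points, ∀ y ∈ Q'.points, ∃ k : ℤ, x - y - Literature.MathematicalPhysics.StatisticalMechanics.layerNormal (x 2 - y 2) - (k : ℝ) • Literature.MathematicalPhysics.StatisticalMechanics.barlowOffset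 a ∈ Submodule.span ℤ ({Literature.MathematicalPhysics.StatisticalMechanics.triangularVec₁ a, Literature.MathematicalPhysics.StatisticalMechanics.triangularVec₂ a} : Set (EuclideanSpace ℝ (Fin 3)))) ∧ (∀ x ∈ Q'.points, ∀ y ∈ Q'.points, x 2 ≠ y 2 → |x 2 - y 2| ≤ 1 → x - y - Literature.MathematicalPhysics.StatisticalMechanics.layerNormal (x 2 - y 2) ∉ Submodule.span ℤ ({Literature.MathematicalPhysics.StatisticalMechanics.triangularVec₁ a, Literature.MathematicalPhysics.StatisticalMechanics.triangularVec₂ a} : Set (EuclideanSpace ℝ (Fin 3))))) → (∀ Q : Literature.MathematicalPhysics.StatisticalMechanics.PeriodicConfiguration 3, ∀ a : ℝ, 47 / 50 ≤ a → a ≤ 1 → Literature.MathematicalPhysics.StatisticalMechanics.triangularVec₁ a ∈ Q.lattice ∧ Literature.MathematicalPhysics.StatisticalMechanics.triangularVec₂ a ∈ Q.lattice ∧ (∀ x ∈ Q.points, ∀ y ∈ Q.points, x 2 = y 2 → x - y ∈ Submodule.span ℤ ({Literature.MathematicalPhysics.StatisticalMechanics.triangularVec₁ a, Literature.MathematicalPhysics.StatisticalMechanics.triangularVec₂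 a} : Set (EuclideanSpace ℝ (Fin 3)))) ∧ (∀ x ∈ Q.points, ∀ y ∈ Q.points, x 2 ≠ y 2 → (7 / 10 : ℝ) ≤ |x 2 - y 2|) ∧ (∀ x ∈ Q.points, ∃ y ∈ Q.points, (7 / 10 : ℝ) ≤ y 2 - x 2 ∧ y 2 - x 2 ≤ 1) ∧ (∀ x ∈ Q.points, ∀ y ∈ Q.points, ∃ k : ℤ, x - y - Literature.MathematicalPhysics.StatisticalMechanics.layerNormal (x 2 - y 2) - (k : ℝ) • Literature.MathematicalPhysics.StatisticalMechanics.barlowOffset a ∈ Submodule.span ℤ ({Literature.MathematicalPhysics.StatisticalMechanics.triangularVec₁ a, Literature.MathematicalPhysics.StatisticalMechanics.triangularVec₂ a} : Set (EuclideanSpace ℝ (Fin 3)))) ∧ (∀ x ∈ Q.points, ∀ y ∈ Q.points, x 2 ≠ y 2 → |x 2 - y 2| ≤ 1 → x - y - Literature.MathematicalPhysics.StatisticalMechanics.layerNormal (x 2 - y 2) ∉ Submodule.span ℤ ({Literature.MathematicalPhysics.StatisticalMechanics.triangularVec₁ a, Literature.MathematicalPhysics.StatisticalMechanics.triangularVec₂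 a} : Set (EuclideanSpace ℝ (Fin 3)))) → ∃ Q' : Literature.MathematicalPhysics.StatisticalMechanics.PeriodicConfiguration 3, ∃ a' : ℝ, 47 / 50 ≤ a' ∧ a' ≤ 1 ∧ Q'.energyPerParticle Literature.MathematicalPhysics.StatisticalMechanics.lennardJones ≤ Q.energyPerParticle Literature.MathematicalPhysics.StatisticalMechanics.lennardJones ∧ (Literature.MathematicalPhysics.StatisticalMechanics.triangularVec₁ a' ∈ Q'.lattice ∧ Literature.MathematicalPhysics.StatisticalMechanics.triangularVec₂ a' ∈ Q'.lattice ∧ (∀ x ∈ Q'.points, ∀ y ∈ Q'.points, x 2 = y 2 → x - y ∈ Submodule.span ℤ ({Literature.MathematicalPhysics.StatisticalMechanics.triangularVec₁ a', Literature.MathematicalPhysics.StatisticalMechanics.triangularVec₂ a'} : Set (EuclideanSpace ℝ (Fin 3)))) ∧ (∀ x ∈ Q'.points, ∀ y ∈ Q'.points, x 2 ≠ y 2 → (7 / 10 : ℝ) ≤ |x 2 - y 2|) ∧ (∀ x ∈ Q'.points, ∃ y ∈ Q'.points, (7 / 10 : ℝ) ≤ y 2 - x 2 ∧ y 2 - x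 2 ≤ 1) ∧ (∀ x ∈ Q'.points, ∀ y ∈ Q'.points, ∃ k : ℤ, x - y - Literature.MathematicalPhysics.StatisticalMechanics.layerNormal (x 2 - y 2) - (k : ℝ) • Literature.MathematicalPhysics.StatisticalMechanics.barlowOffset a' ∈ Submodule.span ℤ ({Literature.MathematicalPhysics.StatisticalMechanics.triangularVec₁ a', Literature.MathematicalPhysics.StatisticalMechanics.triangularVec₂ a'} : Set (EuclideanSpace ℝ (Fin 3)))) ∧ (∀ x ∈ Q'.points, ∀ y ∈ Q'.points, x 2 ≠ y 2 → |x 2 - y 2| ≤ 1 → x - y - Literature.MathematicalPhysics.StatisticalMechanics.layerNormal (x 2 - y 2) ∉ Submodule.span ℤ ({Literature.MathematicalPhysics.StatisticalMechanics.triangularVec₁ a', Literature.MathematicalPhysics.StatisticalMechanics.triangularVec₂ a'} : Set (EuclideanSpace ℝ (Fin 3))))) ∧ (∀ x ∈ Q'.points, ∀ y ∈ Q'.points, x 2 ≠ y 2 → 39 / 50 * a' ≤ |x 2 - y 2|) ∧ (∀ x ∈ Q'.points, ∃ y ∈ Q'.points, 39 / 50 * a' ≤ y 2 - x 2 ∧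 y 2 - x 2 ≤ 17 / 20 * a')) → (∀ Q : Literature.MathematicalPhysics.StatisticalMechanics.PeriodicConfiguration 3, ∀ a : ℝ, 47 / 50 ≤ a → a ≤ 1 → Literature.MathematicalPhysics.StatisticalMechanics.triangularVec₁ a ∈ Q.lattice ∧ Literature.MathematicalPhysics.StatisticalMechanics.triangularVec₂ a ∈ Q.lattice ∧ (∀ x ∈ Q.points, ∀ y ∈ Q.points, x 2 = y 2 → x - y ∈ Submodule.span ℤ ({Literature.MathematicalPhysics.StatisticalMechanics.triangularVec₁ a, Literature.MathematicalPhysics.StatisticalMechanics.triangularVec₂ a} : Set (EuclideanSpace ℝ (Fin 3)))) ∧ (∀ x ∈ Q.points, ∀ y ∈ Q.points, x 2 ≠ y 2 → (7 / 10 : ℝ) ≤ |x 2 - y 2|) ∧ (∀ x ∈ Q.points, ∃ y ∈ Q.points, (7 / 10 : ℝ) ≤ y 2 - x 2 ∧ y 2 - x 2 ≤ 1) ∧ (∀ x ∈ Q.points, ∀ y ∈ Q.points, ∃ k : ℤ, x - y - Literature.MathematicalPhysics.StatisticalMechanics.layerNormal (x 2 - y 2) - (k : ℝ) • Literature.MathematicalPhysics.StatisticalMechanics.barlowOffset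 a ∈ Submodule.span ℤ ({Literature.MathematicalPhysics.StatisticalMechanics.triangularVec₁ a, Literature.MathematicalPhysics.StatisticalMechanics.triangularVec₂ a} : Set (EuclideanSpace ℝ (Fin 3)))) ∧ (∀ x ∈ Q.points, ∀ y ∈ Q.points, x 2 ≠ y 2 → |x 2 - y 2| ≤ 1 → x - y - Literature.MathematicalPhysics.StatisticalMechanics.layerNormal (x 2 - y 2) ∉ Submodule.span ℤ ({Literature.MathematicalPhysics.StatisticalMechanics.triangularVec₁ a, Literature.MathematicalPhysics.StatisticalMechanics.triangularVec₂ a} : Set (EuclideanSpace ℝ (Fin 3)))) → (∀ x ∈ Q.points, ∀ y ∈ Q.points, x 2 ≠ y 2 → 39 / 50 * a ≤ |x 2 - y 2|) ∧ (∀ x ∈ Q.points, ∃ y ∈ Q.points, 39 / 50 * a ≤ y 2 - x 2 ∧ y 2 - x 2 ≤ 17 / 20 * a) → ∃ a' h : ℝ, ∃ (ha : a' ≠ 0) (hh : h ≠ 0), 47 / 50 ≤ a' ∧ a' ≤ 1 ∧ 39 / 50 * a' ≤ h ∧ h ≤ 17 / 20 * a' ∧ (Literature.MathematicalPhysics.StatisticalMechanics.hcpPeriodicConfiguration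 ha hh).energyPerParticle Literature.MathematicalPhysics.StatisticalMechanics.lennardJones ≤ Q.energyPerParticle Literature.MathematicalPhysics.StatisticalMechanics.lennardJones) → Summit.AtomisticToContinuum.Crystallization.Theses.SymmetryRankLadder.MonolayerStackOptimality := by
  intro h₁ h₂ h₃ Q a ha₁ ha₂ hmono
  obtain ⟨Q₁, hQ₁, hH₁⟩ := h₁ Q a ha₁ ha₂ hmono
  obtain ⟨Q₂, a', ha'₁, ha'₂, hQ₂, hH₂, hB₂⟩ := h₂ Q₁ a ha₁ ha₂ hH₁
  obtain ⟨a'', h, ha, hh, hb₁, hb₂, hb₃, hb₄, hle⟩ := h₃ Q₂ a' ha'₁ ha'₂ hH₂ hB₂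
  exact ⟨a'', h, ha, hh, hb₁, hb₂, hb₃, hb₄, hle.trans (hQ₂.trans hQ₁)⟩

/-- The crux modulo exactly the three stubs. -/
theorem MonolayerStackOptimality_proof : Summit.AtomisticToContinuum.Crystallization.Theses.SymmetryRankLadder.MonolayerStackOptimality :=
  MonolayerStackOptimality_of stub_offsetHoleLocking stub_spacingBoxing stub_boxedHoleStackBelowHcp

end Summit.AtomisticToContinuum.Crystallization.Cruxes.MonolayerStackOptimality.Birth
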